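import Summits.ABC.IUTFork.Charitable.Thm311D2Countermodel
import Summits.ABC.IUTFork.Charitable.Thm311D2Derive
import HarnessLib

/-!
# [IUTchIII] Thm 3.11, charitable re-typing D2 — deliverable (b) in SCHEMA form (branch D, team D2 adversary; rung LADDER-ABC:A2.D)

Companion to `Charitable/Thm311D2Countermodel.lean` (p430059): the same kernel facts, restated as NEGATED DERIVATION SCHEMAS so
that the branch question reads off literally. With `S := Cor312Vol.PilotKummerIndRelated` and the three pins `PinnedRegions3`:
 * `not_derivation_minus_square` — «typed Thm 3.11 of record ∧ bridge hypotheses ∧ |log(q)| > 0 ∧ (Thm311Charitable_2 minus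
   `III_c_KummerLinkSquare`) ∧ pins ⟹ S» is REFUTED as a schema (witness: the pinned `2`-adic countermodel of record);
 * `not_derivation_minus_square_statement` — nor does that sub-typing give the typed inequality of Cor. 3.12 under the pins;
 * `not_derivation_hull` — «… ∧ Thm311Charitable_2H ∧ pins ⟹ S» is REFUTED as a schema (witness: the `d = 3` log-shell model; the
   inequality holds there — team D2-prv's (a-hull) line derives it from `2H`).
Together with team D2-prv's (a) line (`III_c_KummerLinkSquare ∧ I_PermSymmetric ∧ II_b_SplittingKummer ⟹ S`, p428699) this localises
the branch question for team D2's typing to ONE clause: the datum-level square reading of Thm 3.11 (iii)(c)'s final sentence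
(kurims `paper:url-4b091feeb646` p. 158 l. 6–15). TAKES NO SIDE on [IUTchIII] Cor. 3.12 or on any author; locates / conditionally
verifies; typed ≠ proved; establishment = our kernel check. [claim: Mochizuki2012, status: disputed]
-/

noncomputable section

namespace Summit.ABC.IUTFork.Charitable.D2

open Thm311 Cor312 Cor312Vol Cor312Vol.PinnedWitness Cor312Vol.NaiveWitness Cor312Vol.PinnedHonest Literature.IUT.LogThetaLattice

/-- **«(Thm311Charitable_2 ∖ {III_c_KummerLinkSquare}) ∧ PinnedRegions3 ⟹ S» is REFUTED as a schema** — even granted the typed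
Thm 3.11 of record, every bridge hypothesis and `|log(q)| > 0`. Witness: `countermodel_2_minus_square` (p430059).
[claim: Mochizuki2012, status: disputed] -/
@[claim "Mochizuki2012" "disputed"]
theorem not_derivation_minus_square :
    ¬ ∀ (T : ThetaIndex) (F : FullSituation T) (P : Cor312.Setting F.toLatticeSituation.toSituation)
        (ρ : (∀ v : T.V, v ∈ T.Vbad → Set (F.L.StarPacket v)) → ∀ (j : T.Label) (vQ : T.VQ), Set (F.L.Packet j vQ))
        (qK : ∀ v : T.V, v ∈ T.Vbad → Set (F.L.StarPacket v)),
        F.Statement → BridgeHyps P → P.AbsLogQPos →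
          (PartI F.toLatticeSituation ∧ PartII F.toLatticeSituation ∧ III_ab_UnitPortionLink F.toLatticeSituation ∧
            III_c_Stabilized F.toLatticeSituation ∧ III_d_NumberFieldLink F.toLatticeSituation) →
          PinnedRegions3 F.toLatticeSituation P ρ qK → PilotKummerIndRelated F.toLatticeSituation P ρ qK :=
  fun h => pinnedSetting_not_pilotKummerIndRelated 2 (h _ _ _ _ _ (naiveFull_statement 2) (pinnedSetting_bridgeHyps 2)
    (pinnedSetting_absLogQPos 2) (charitable_2_minus_square_holds 2) (pinnedSetting_pinnedRegions3 2))

/-- … nor does the sub-typing give the typed inequality of Cor. 3.12 under the pins (honest volumes `−(5/2)·log 2 < −log 2`).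
[claim: Mochizuki2012, status: disputed] -/
@[claim "Mochizuki2012" "disputed"]
theorem not_derivation_minus_square_statement :
    ¬ ∀ (T : ThetaIndex) (F : FullSituation T) (P : Cor312.Setting F.toLatticeSituation.toSituation)
        (ρ : (∀ v : T.V, v ∈ T.Vbad → Set (F.L.StarPacket v)) → ∀ (j : T.Label) (vQ : T.VQ), Set (F.L.Packet j vQ))
        (qK : ∀ v : T.V, v ∈ T.Vbad → Set (F.L.StarPacket v)),
        F.Statement → BridgeHyps P → P.AbsLogQPos →
          (PartI F.toLatticeSituation ∧ PartII F.toLatticeSituation ∧ III_ab_UnitPortionLink F.toLatticeSituation ∧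
            III_c_Stabilized F.toLatticeSituation ∧ III_d_NumberFieldLink F.toLatticeSituation) →
          PinnedRegions3 F.toLatticeSituation P ρ qK → P.Statement :=
  fun h => pinnedSetting_not_statement 2 (h _ _ _ _ _ (naiveFull_statement 2) (pinnedSetting_bridgeHyps 2)
    (pinnedSetting_absLogQPos 2) (charitable_2_minus_square_holds 2) (pinnedSetting_pinnedRegions3 2))

/-- **«Thm311Charitable_2H ∧ PinnedRegions3 ⟹ S» is REFUTED as a schema** (the hull-level alternative licenses the inequality, not
the identification-level residual). Witness: `hull_variant_no_S` at the `d = 3` log-shell model. [claim: Mochizuki2012, status: disputed] -/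
@[claim "Mochizuki2012" "disputed"]
theorem not_derivation_hull :
    ¬ ∀ (T : ThetaIndex) (F : FullSituation T) (P : Cor312.Setting F.toLatticeSituation.toSituation)
        (ρ : (∀ v : T.V, v ∈ T.Vbad → Set (F.L.StarPacket v)) → ∀ (j : T.Label) (vQ : T.VQ), Set (F.L.Packet j vQ))
        (qK : ∀ v : T.V, v ∈ T.Vbad → Set (F.L.StarPacket v)),
        F.Statement → BridgeHyps P → P.AbsLogQPos → Thm311Charitable_2H F.toLatticeSituation P ρ qK →
          PinnedRegions3 F.toLatticeSituation P ρ qK → PilotKummerIndRelated F.toLatticeSituation P ρ qK :=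
  fun h => (hull_variant_no_S 2).2.2.2.2.1 (h _ _ _ _ _ (naiveFull_statement 2) (hull_variant_no_S 2).2.1
    (hull_variant_no_S 2).2.2.1 (hull_variant_no_S 2).1 (hull_variant_no_S 2).2.2.2.1)

/-- **ONE-BIT LOCALISATION for team D2's typing** (both directions kernel facts of the cell): WITH the square, `S` follows for every
model, operator and pins (team D2-prv's (a) line, used here through `Thm311Charitable_2`); WITHOUT it, the remaining ten clauses have an
honest pinned countermodel. [claim: Mochizuki2012, status: disputed] -/
@[claim "Mochizuki2012" "disputed"]
theorem square_is_the_bit :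
    (∀ (T : ThetaIndex) (F : FullSituation T) (P : Cor312.Setting F.toLatticeSituation.toSituation)
        (ρ : (∀ v : T.V, v ∈ T.Vbad → Set (F.L.StarPacket v)) → ∀ (j : T.Label) (vQ : T.VQ), Set (F.L.Packet j vQ))
        (qK : ∀ v : T.V, v ∈ T.Vbad → Set (F.L.StarPacket v)),
        I_PermSymmetric F.toLatticeSituation → II_b_SplittingKummer F.toLatticeSituation →
          III_c_KummerLinkSquare F.toLatticeSituation P.n qK → PilotKummerIndRelated F.toLatticeSituation P ρ qK) ∧
    ¬ ∀ (T : ThetaIndex) (F : FullSituation T) (P : Cor312.Setting F.toLatticeSituation.toSituation)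
        (ρ : (∀ v : T.V, v ∈ T.Vbad → Set (F.L.StarPacket v)) → ∀ (j : T.Label) (vQ : T.VQ), Set (F.L.Packet j vQ))
        (qK : ∀ v : T.V, v ∈ T.Vbad → Set (F.L.StarPacket v)),
        F.Statement → BridgeHyps P → P.AbsLogQPos →
          (PartI F.toLatticeSituation ∧ PartII F.toLatticeSituation ∧ III_ab_UnitPortionLink F.toLatticeSituation ∧
            III_c_Stabilized F.toLatticeSituation ∧ III_d_NumberFieldLink F.toLatticeSituation) →
          PinnedRegions3 F.toLatticeSituation P ρ qK → PilotKummerIndRelated F.toLatticeSituation P ρ qK :=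
  ⟨fun _ F P ρ qK hperm hb hsq => pilotKummerIndRelated_of_square F.toLatticeSituation P ρ qK hperm hb hsq,
    not_derivation_minus_square⟩

end Summit.ABC.IUTFork.Charitable.D2

end
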